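import Summits.AtomisticToContinuum.Crystallization.Theorems.FreeSplittingCertificatesStrictSplittingRuleFarMollifyLocal
import Summits.AtomisticToContinuum.Crystallization.Theorems.FreeSplittingCertificatesStrictSplittingRuleFarPencilP1Bounds

/-!
# `StrictSplittingRule` (stmt-AtomisticToContinuum-12560): the far pencil for LIPSCHITZ, LOCALLY AFFINE fields with affine tail (the P1 class)

Route `FreeSplittingCertificates`, crux r3 `StrictSplittingRule` (H12⋆ = `stub_coreJointCoercive`), unit b2b-freesplit-B gen 12.
VALUE = the continuum far theorem in the generality the lattice→continuum transfer consumes — NOT a proof of H12⋆, NOT summit progress.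

`farPencil_weighted_integral_le_of_affineTail` (…FarPencilGrowthIntegral) is stated for `C²` fields.  The P1 interpolant `ṽ` of a lattice displacement is only
continuous, Lipschitz, and affine on each (open) element — i.e. locally affine off the null set of element faces — and affine outside a ball.  This file passes the
far inequality to that class by the density route of HOME FAR-LEMMA-SPEC §10 (e): mollify (`φ̃_δ ⋆ ṽ` is `C²` with the same affine tail, …FarMollifyAffine /
…FarMollifyLocal), apply the `C²` theorem, and let `δ → 0` by dominated convergence (…FarPencilP1Bounds) — off the faces the mollified field coincides with `ṽ`
near the point for small `δ`, so all three integrands are eventually constant pointwise a.e.; the dominating functions come from the uniform Lipschitz bound.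
Main result: `farPencil_weighted_integral_le_of_locallyAffine`.
-/

noncomputable section

open MeasureTheory Topology Filter Asymptotics ContinuousLinearMap Metric
open scoped Convolution NNReal

namespace Summit.AtomisticToContinuum.Crystallization.Theorems.StrictSplittingRuleBirth

/-! ## The far pencil for the P1 class -/

/-- **Far pencil (`17/200`) for Lipschitz fields that are locally affine off a null set and affine outside a ball.**
Let `v : ℝ³ → ℝ³` be `K`-Lipschitz, affine (`v = b + y·A`) for `‖y‖ ≥ R`, and near every point outside a null set `S` equal to an affine map on a ball
(the continuous piecewise-affine interpolants of lattice displacements are exactly of this kind, `S` = the element faces); let `χ ∈ C²` vanish near `0`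
and equal `1` for `‖y‖ ≥ R`.  Then, with `∇v := fderiv` (the honest element gradient off `S`),
`∫ χ²·Num(v) ≤ (17/200)∫ χ²·Den(v) + (1/18)∫ 2χ⟪∇χ, Φ(v)⟫`.
Proof: mollify (`φ̃_δ ⋆ v` is `C²`, `K`-Lipschitz, with the same affine tail beyond `R + 1`), apply `farPencil_weighted_integral_le_of_affineTail`, and let
`δ → 0` by dominated convergence (integrands eventually constant off `S`; domination by `abs_fpNum_le` / `abs_fpDen_le` / `abs_fpFlux_le`). -/
theorem farPencil_weighted_integral_le_of_locallyAffine {v : (Fin 3 → ℝ) → (Fin 3 → ℝ)} {χ : (Fin 3 → ℝ) → ℝ} {K : ℝ≥0}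
    {R : ℝ} {b : Fin 3 → ℝ} {A : Fin 3 → Fin 3 → ℝ} {S : Set (Fin 3 → ℝ)} (hv : LipschitzWith K v) (hS : volume S = 0)
    (hloc : ∀ x, x ∉ S → ∃ r > 0, ∃ L : (Fin 3 → ℝ) →L[ℝ] (Fin 3 → ℝ), ∀ y ∈ ball x r, v y = v x + L (y - x))
    (hχ : ContDiff ℝ 2 χ) (hχ0 : (0 : Fin 3 → ℝ) ∉ tsupport χ)
    (htail : ∀ y : Fin 3 → ℝ, R ≤ ‖y‖ → ∀ j, v y j = b j + (y 0 * A 0 j + y 1 * A 1 j + y 2 * A 2 j))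
    (hχ1 : ∀ y : Fin 3 → ℝ, R ≤ ‖y‖ → χ y = 1) :
    ∫ x, χ x ^ 2 * fpNum x (v x) (fpGrad v x) ≤
      17 / 200 * (∫ x, χ x ^ 2 * fpDen x (fpGrad v x)) + 1 / 18 * ∫ x, 2 * χ x * fpFluxDotGrad v χ x := by
  -- the bump sequence `rOut = 1/(n+1)`
  let φ : ℕ → ContDiffBump (0 : Fin 3 → ℝ) := fun n =>
    ⟨1 / (2 * ((n : ℝ) + 1)), 1 / ((n : ℝ) + 1), by positivity,
      one_div_lt_one_div_of_lt (by positivity) (by linarith)⟩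
  have hφout : ∀ n, (φ n).rOut = 1 / ((n : ℝ) + 1) := fun n => rfl
  have hφle1 : ∀ n, (φ n).rOut ≤ 1 := fun n => by
    rw [hφout, div_le_one (by positivity)]; linarith [(Nat.cast_nonneg n : (0 : ℝ) ≤ n)]
  have hφto : Tendsto (fun n => (φ n).rOut) atTop (𝓝 0) := by
    simp only [hφout]; exact tendsto_one_div_add_atTop_nhds_zero_nat
  let u : ℕ → (Fin 3 → ℝ) → (Fin 3 → ℝ) := fun n => (φ n).normed volume ⋆[lsmul ℝ ℝ, volume] v
  have hvc : Continuous v := hv.continuous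
  have hu2 : ∀ n, ContDiff ℝ 2 (u n) := fun n => normed_convolution_smooth (φ n) hvc
  have huc : ∀ n, Continuous (u n) := fun n => (hu2 n).continuous
  have hutail : ∀ n, ∀ y : Fin 3 → ℝ, R + 1 ≤ ‖y‖ → ∀ j, u n y j = b j + (y 0 * A 0 j + y 1 * A 1 j + y 2 * A 2 j) :=
    fun n y hy j => mollify_affineTail (φ n) htail y (by linarith [hφle1 n]) j
  have hχ1' : ∀ y : Fin 3 → ℝ, R + 1 ≤ ‖y‖ → χ y = 1 := fun y hy => hχ1 y (by linarith)
  -- the `C²` far theorem along the sequence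
  have hfar : ∀ n, ∫ x, χ x ^ 2 * fpNum x (u n x) (fpGrad (u n) x) ≤
      17 / 200 * (∫ x, χ x ^ 2 * fpDen x (fpGrad (u n) x)) + 1 / 18 * ∫ x, 2 * χ x * fpFluxDotGrad (u n) χ x :=
    fun n => farPencil_weighted_integral_le_of_affineTail (hu2 n) hχ hχ0 (hutail n) hχ1'
  -- uniform bounds: `|∂(u n)| ≤ K`, `‖u n x‖ ≤ V + K‖x‖` with `V = ‖v 0‖ + K`
  set V : ℝ := ‖v 0‖ + K with hV
  have hK0 : (0 : ℝ) ≤ K := K.2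
  have hV0 : 0 ≤ V := by positivity
  have hGn : ∀ n x i j, |fpGrad (u n) x i j| ≤ K := fun n x i j => abs_fpGrad_normed_convolution_le (φ n) hv x i j
  have hwn : ∀ n x, ‖u n x‖ ≤ V + K * ‖x‖ := fun n x => by
    have h1 := norm_normed_convolution_le (φ n) hv x
    have h2 := norm_le_of_lipschitz hv x
    have h3 : (K : ℝ) * (φ n).rOut ≤ K := by nlinarith [hφle1 n, (φ n).rOut_pos]
    rw [hV]; linarith
  have hGv : ∀ x i j, |fpGrad v x i j| ≤ K := fun x i j => abs_fpGrad_le_of_lipschitz hv x i j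
  have hwv : ∀ x, ‖v x‖ ≤ V + K * ‖x‖ := fun x => by
    have h2 := norm_le_of_lipschitz hv x
    rw [hV]; nlinarith [norm_nonneg x]
  -- pointwise eventual equality off `S`
  have hev : ∀ x, x ∉ S → ∀ᶠ n in atTop, u n x = v x ∧ fpGrad (u n) x = fpGrad v x := by
    intro x hx
    obtain ⟨r, hr, L, hL⟩ := hloc x hx
    have hn : ∀ᶠ n in atTop, (φ n).rOut < r := (tendsto_order.1 hφto).2 r hr
    filter_upwards [hn] with n hn
    refine ⟨normed_convolution_apply_eq_of_affine_near (φ n) L hL hn, ?_⟩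
    funext i j
    unfold fpGrad
    rw [fderiv_normed_convolution_eq_of_affine_near (φ n) L hL hn]
  have hae : ∀ᵐ x ∂(volume : Measure (Fin 3 → ℝ)), x ∉ S := measure_eq_zero_iff_ae_notMem.1 hS
  -- (1) demand integrals converge
  have hlimN : Tendsto (fun n => ∫ x, χ x ^ 2 * fpNum x (u n x) (fpGrad (u n) x)) atTop
      (𝓝 (∫ x, χ x ^ 2 * fpNum x (v x) (fpGrad v x))) := by
    refine tendsto_integral_of_dominated_convergence
      (fun x => χ x ^ 2 * (111 / 8 * (K : ℝ) ^ 2 * (fpSq x)⁻¹ ^ 3 + 27 / 2 * V ^ 2 * (fpSq x)⁻¹ ^ 4))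
      (fun n => (measurable_chiSq_mul_fpNum (huc n) hχ.continuous).aestronglyMeasurable)
      (integrable_chiSq_mul_invPow hχ hχ0 hχ1 _ _) (fun n => ae_of_all _ fun x => ?_) ?_
    · rw [Real.norm_eq_abs, abs_mul, abs_of_nonneg (sq_nonneg _)]
      exact mul_le_mul_of_nonneg_left (abs_fpNum_le (hGn n x) (hwn n x)) (sq_nonneg _)
    · filter_upwards [hae] with x hx
      refine (tendsto_const_nhds (x := χ x ^ 2 * fpNum x (v x) (fpGrad v x))).congr' ?_
      filter_upwards [hev x hx] with n hn
      rw [hn.1, hn.2]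
  -- (2) receipt integrals converge
  have hlimD : Tendsto (fun n => ∫ x, χ x ^ 2 * fpDen x (fpGrad (u n) x)) atTop
      (𝓝 (∫ x, χ x ^ 2 * fpDen x (fpGrad v x))) := by
    refine tendsto_integral_of_dominated_convergence
      (fun x => χ x ^ 2 * (108 / 5 * (K : ℝ) ^ 2 * (fpSq x)⁻¹ ^ 3 + 0 * (fpSq x)⁻¹ ^ 4))
      (fun n => (measurable_chiSq_mul_fpDen (v := u n) hχ.continuous).aestronglyMeasurable)
      (integrable_chiSq_mul_invPow hχ hχ0 hχ1 _ _) (fun n => ae_of_all _ fun x => ?_) ?_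
    · rw [Real.norm_eq_abs, abs_mul, abs_of_nonneg (sq_nonneg _), zero_mul, add_zero]
      exact mul_le_mul_of_nonneg_left (abs_fpDen_le (hGn n x)) (sq_nonneg _)
    · filter_upwards [hae] with x hx
      refine (tendsto_const_nhds (x := χ x ^ 2 * fpDen x (fpGrad v x))).congr' ?_
      filter_upwards [hev x hx] with n hn
      rw [hn.2]
  -- (3) flux integrals converge
  have hlimF : Tendsto (fun n => ∫ x, 2 * χ x * fpFluxDotGrad (u n) χ x) atTop
      (𝓝 (∫ x, 2 * χ x * fpFluxDotGrad v χ x)) := by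
    refine tendsto_integral_of_dominated_convergence
      (fun x => (|2 * χ x * fpGradS χ x 0| + |2 * χ x * fpGradS χ x 1| + |2 * χ x * fpGradS χ x 2|) *
        (24 * (fpSq x)⁻¹ ^ 4 * ‖x‖ * (V + K * ‖x‖) ^ 2 + 6 * K * (fpSq x)⁻¹ ^ 3 * (V + K * ‖x‖)))
      (fun n => (measurable_two_chi_fluxDotGrad (huc n) hχ).aestronglyMeasurable)
      (integrable_fluxBound hχ hχ0 hχ1 6 24 K V) (fun n => ae_of_all _ fun x => ?_) ?_
    · have hB : ∀ j, |fpFlux (u n) x j| ≤ 24 * (fpSq x)⁻¹ ^ 4 * ‖x‖ * (V + K * ‖x‖) ^ 2 + 6 * K * (fpSq x)⁻¹ ^ 3 * (V + K * ‖x‖) :=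
        fun j => abs_fpFlux_le hK0 (by nlinarith [norm_nonneg x]) (hGn n x) (hwn n x) j
      set B := 24 * (fpSq x)⁻¹ ^ 4 * ‖x‖ * (V + K * ‖x‖) ^ 2 + 6 * K * (fpSq x)⁻¹ ^ 3 * (V + K * ‖x‖) with hBdef
      have hB0 : 0 ≤ B := le_trans (abs_nonneg _) (hB 0)
      rw [Real.norm_eq_abs]
      unfold fpFluxDotGrad
      have e : ∀ j, |2 * χ x * (fpGradS χ x j * fpFlux (u n) x j)| ≤ |2 * χ x * fpGradS χ x j| * B := fun j => by
        rw [← mul_assoc, abs_mul]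
        exact mul_le_mul_of_nonneg_left (hB j) (abs_nonneg _)
      calc |2 * χ x * (fpGradS χ x 0 * fpFlux (u n) x 0 + fpGradS χ x 1 * fpFlux (u n) x 1 + fpGradS χ x 2 * fpFlux (u n) x 2)|
          = |2 * χ x * (fpGradS χ x 0 * fpFlux (u n) x 0) + 2 * χ x * (fpGradS χ x 1 * fpFlux (u n) x 1) +
              2 * χ x * (fpGradS χ x 2 * fpFlux (u n) x 2)| := by ring_nf
        _ ≤ |2 * χ x * (fpGradS χ x 0 * fpFlux (u n) x 0)| + |2 * χ x * (fpGradS χ x 1 * fpFlux (u n) x 1)| +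
              |2 * χ x * (fpGradS χ x 2 * fpFlux (u n) x 2)| := abs_add_three _ _ _
        _ ≤ |2 * χ x * fpGradS χ x 0| * B + |2 * χ x * fpGradS χ x 1| * B + |2 * χ x * fpGradS χ x 2| * B := by
              linarith [e 0, e 1, e 2]
        _ = (|2 * χ x * fpGradS χ x 0| + |2 * χ x * fpGradS χ x 1| + |2 * χ x * fpGradS χ x 2|) * B := by ring
    · filter_upwards [hae] with x hx
      refine (tendsto_const_nhds (x := 2 * χ x * fpFluxDotGrad v χ x)).congr' ?_
      filter_upwards [hev x hx] with n hn
      have hf : ∀ j, fpFlux (u n) x j = fpFlux v x j := fun j => by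
        unfold fpFlux; rw [hn.1, hn.2]
      unfold fpFluxDotGrad
      rw [hf 0, hf 1, hf 2]
  -- pass to the limit in the inequality
  have hlimR : Tendsto (fun n => 17 / 200 * (∫ x, χ x ^ 2 * fpDen x (fpGrad (u n) x)) + 1 / 18 * ∫ x, 2 * χ x * fpFluxDotGrad (u n) χ x)
      atTop (𝓝 (17 / 200 * (∫ x, χ x ^ 2 * fpDen x (fpGrad v x)) + 1 / 18 * ∫ x, 2 * χ x * fpFluxDotGrad v χ x)) :=
    (hlimD.const_mul _).add (hlimF.const_mul _)
  exact le_of_tendsto_of_tendsto' hlimN hlimR hfar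

end Summit.AtomisticToContinuum.Crystallization.Theorems.StrictSplittingRuleBirth
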